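import Literature.AlgebraicGeometry.Frobenioids.ArithmeticFrobenioidDivisorTransportSquare
import HarnessLib

/-!
# Frobenioids I, Thm. 6.4 (iii) for an arbitrary `Ψ′` — piece (G2) in the θ-letter: the perfected divisor
# transport `θ` of `Ψ′` at `A` against `Ψ^rlf`'s transport through the square

Mochizuki, *The geometry of Frobenioids I: the general theory*, Kyushu J. Math. **62** (2008) 293–400,
Thm. 6.4 (iii) p. 114, proof p. 115 l. 44 – p. 116 l. 4; Cor. 4.11 (iv) p. 92; Prop. 5.3 p. 103.
[cite: MochizukiFrdI2008, Thm. 6.4 (iii) p.114] [cite: MochizukiFrdI2008, Cor. 4.11 (iv) p.92]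

PROOF-ONLY sequel of `ArithmeticFrobenioidDivisorTransportSquare` (cell abc-iut, seat abc-iut-L1-d2; row
«T64iii-ARBITRARY-Ψ′» piece (G2), L1-lead R129 (1)), in the letter the assembler abc-iut-L1-t3 (STATUS 10:03:23Z
`hG2`) and the (G3) holder abc-iut-L1-d9 (`hG2′` of `exists_placeMap_thm64iii_arith_of_classClause′`, p436882)
consume: the transport of `Ψ′` enters ONLY through a function `θ : Φ₁^pf(Base A) → Φ₂^pf(Base (Ψ′A))` with its
Div-clause `θ(Div φ) = Div(Ψ′ φ)` for arrows `φ` out of `A` (abc-iut-L1-d1's `exists_perfectedDivisorTransport_pfUntr_at_arith`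
letter, p428043) — no `ΨBase′`, `E′`, `η′` — and the base isomorphism produced is
`γ_A : Base(Ψ′A) ≅ ΨBase(Base A)`, `γ_A = (β₂_{Ψ′A})⁻¹ ≫ Base(σ_A) ≫ η^rlf_{u₁A} ≫ ΨBase(β₁_A)`:

* `PreFrobenioidData.transport_square_compat_of_divClause` — `ι₂(θ(Div φ)) = γ_A^* E^rlf_X(ι₁(Div φ))`, `X = Base A`;
* `PreFrobenioidData.exists_baseIso_transport_compat_of_divClause` — `∃ γ : Base(Ψ′A) ≅ ΨBase(X)`, `γ.hom =` the
  composite, and `∀ m ∈ Φ₁^pf(X)`, `ι₂(θ m) = γ^* E^rlf_X(ι₁ m)`, given that every `m` is a `Div` of an arrow out of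
  `A` (Def. 1.3 (ii)).
Same GENERIC `PreFrobenioidData` setting and proof as the parent file (Div of the naturality square of `σ`,
iso components isometric and linear over the sharp `Φ₂^rlf`, Div-clauses of `u₁`, `u₂`, `Ψ^rlf`, naturality of
`E^rlf`, `pull_comp`).  Nothing here is specific to the abc programme; no side taken on [IUTchIII] Cor. 3.12.
-/

namespace Literature.AlgebraicGeometry.Frobenioids

namespace PreFrobenioidData

open CategoryTheory

section Square

variable {U₁ : Type*} [Category U₁] {U₂ : Type*} [Category U₂] {R₁ : Type*} [Category R₁] {R₂ : Type*} [Category R₂]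
  {D₁ : Type*} [Category D₁] {D₂ : Type*} [Category D₂]
  (SU₁ : PreFrobenioidData U₁ D₁) (SU₂ : PreFrobenioidData U₂ D₂)
  (SR₁ : PreFrobenioidData R₁ D₁) (SR₂ : PreFrobenioidData R₂ D₂)
  -- `ι_i : Φ_i^pf → Φ_i^rlf`
  (ι₁ : ∀ X : D₁, SU₁.Mon X →* SR₁.Mon X) (ι₂ : ∀ X : D₂, SU₂.Mon X →* SR₂.Mon X)
  -- the natural functors `u_i : (C_i^pf)^un-tr → C_i^rlf`, over `D_i` up to `β_i`, with their Div-clauses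
  (u₁ : U₁ ⥤ R₁) (β₁ : u₁ ⋙ SR₁.base ≅ SU₁.base)
  (hu₁ : ∀ ⦃A B : U₁⦄ (φ : A ⟶ B), SR₁.div (u₁.map φ) = SR₁.pull (β₁.hom.app A) (ι₁ _ (SU₁.div φ)))
  (u₂ : U₂ ⥤ R₂) (β₂ : u₂ ⋙ SR₂.base ≅ SU₂.base)
  (hu₂ : ∀ ⦃A B : U₂⦄ (φ : A ⟶ B), SR₂.div (u₂.map φ) = SR₂.pull (β₂.hom.app A) (ι₂ _ (SU₂.div φ)))
  -- `Ψ′` (only the functor; its transport enters through `θ` below)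
  (Ψ' : U₁ ⥤ U₂)
  -- `Ψ^rlf` with its Cor. 4.11 data `(ΨBase, E^rlf, η^rlf)` and Div-clause
  (Ψr : R₁ ⥤ R₂) (ΨB : D₁ ⥤ D₂) (Er : DivisorMonoidIsoOverBase SR₁ SR₂ ΨB) (ηr : Ψr ⋙ SR₂.base ≅ SR₁.base ⋙ ΨB)
  (hΨr : ∀ ⦃P Q : R₁⦄ (ψ : P ⟶ Q), SR₂.div (Ψr.map ψ) = SR₂.pull (ηr.hom.app P) (Er.iso _ (SR₁.div ψ)))
  -- the `1`-commutative square and sharpness of `Φ₂^rlf`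
  (σ : Ψ' ⋙ u₂ ≅ u₁ ⋙ Ψr) (hsharp : ∀ Y : D₂, IsSharp (SR₂.Mon Y))

include hu₁ hu₂ hΨr hsharp

/-- **(G2), θ-letter.** For `φ : A → B` of `(C₁^pf)^un-tr` and any `θ : Φ₁^pf(Base A) → Φ₂^pf(Base (Ψ′A))` with
`θ(Div φ) = Div(Ψ′ φ)`: `ι₂(θ(Div φ)) = γ_A^*(E^rlf_X(ι₁(Div φ)))` with `X = Base A` and
`γ_A = (β₂_{Ψ′A})⁻¹ ≫ Base(σ_A) ≫ η^rlf_{u₁A} ≫ ΨBase(β₁_A)`. [cite: MochizukiFrdI2008, Thm. 6.4 (iii) p.114] -/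
theorem transport_square_compat_of_divClause {A B : U₁} (φ : A ⟶ B)
    (θ : SU₁.Mon (SU₁.base.obj A) → SU₂.Mon (SU₂.base.obj (Ψ'.obj A))) (hθ : θ (SU₁.div φ) = SU₂.div (Ψ'.map φ)) :
    ι₂ _ (θ (SU₁.div φ)) =
      SR₂.pull (β₂.inv.app (Ψ'.obj A) ≫ SR₂.base.map (σ.hom.app A) ≫ ηr.hom.app (u₁.obj A) ≫ ΨB.map (β₁.hom.app A))
        (Er.iso (SU₁.base.obj A) (ι₁ _ (SU₁.div φ))) := by
  -- the components of `σ` are isomorphisms: `Div = 0`, `deg_Fr = 1`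
  have hσA : SR₂.div (σ.hom.app A) = 1 := SR₂.div_hom_eq_one_of_iso (hsharp _) (σ.app A)
  have hσB : SR₂.div (σ.hom.app B) = 1 := SR₂.div_hom_eq_one_of_iso (hsharp _) (σ.app B)
  have hdB : SR₂.degFr (σ.hom.app B) = 1 := SR₂.degFr_hom_eq_one_of_iso (σ.app B)
  -- `Div` of the naturality square of `σ` at `φ`
  have hdiv := congrArg SR₂.div (σ.hom.naturality φ)
  rw [SR₂.div_comp, SR₂.div_comp, hσB, hσA, hdB, map_one, one_mul, PNat.one_coe, pow_one, one_pow,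
    mul_one] at hdiv
  have hdiv' : SR₂.div (u₂.map (Ψ'.map φ)) = SR₂.pull (SR₂.base.map (σ.hom.app A)) (SR₂.div (Ψr.map (u₁.map φ))) :=
    hdiv
  -- right-hand side through the Div-clauses of `Ψ^rlf`, `u₁` and the naturality of `E^rlf`
  have hR : SR₂.div (Ψr.map (u₁.map φ)) =
      SR₂.pull (ηr.hom.app (u₁.obj A) ≫ ΨB.map (β₁.hom.app A)) (Er.iso (SU₁.base.obj A) (ι₁ _ (SU₁.div φ))) := by
    refine (hΨr (u₁.map φ)).trans ?_
    refine (congrArg (fun x => SR₂.pull (ηr.hom.app (u₁.obj A)) (Er.iso _ x)) (hu₁ φ)).trans ?_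
    refine (congrArg (fun x => SR₂.pull (ηr.hom.app (u₁.obj A)) x) (Er.natural (β₁.hom.app A) _)).trans ?_
    exact (SR₂.pull_comp _ _ _).symm
  -- left-hand side: `ι₂(θ(Div φ)) = ι₂(Div(Ψ′φ)) = (β₂⁻¹)^* Div(u₂ Ψ′ φ)`
  have hL : ι₂ _ (θ (SU₁.div φ)) = SR₂.pull (β₂.inv.app (Ψ'.obj A)) (SR₂.div (u₂.map (Ψ'.map φ))) := by
    refine (congrArg (fun x => ι₂ _ x) hθ).trans ?_
    refine Eq.trans ?_ (congrArg (fun x => SR₂.pull (β₂.inv.app (Ψ'.obj A)) x) (hu₂ (Ψ'.map φ))).symm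
    refine Eq.trans ?_ (SR₂.pull_comp _ _ _)
    exact ((SR₂.pull_id _ _).symm.trans
      (congrArg (fun f => SR₂.pull f (ι₂ _ (SU₂.div (Ψ'.map φ)))) (β₂.inv_hom_id_app (Ψ'.obj A)).symm))
  refine hL.trans ?_
  refine (congrArg (fun x => SR₂.pull (β₂.inv.app (Ψ'.obj A)) x) hdiv').trans ?_
  refine (congrArg (fun x => SR₂.pull (β₂.inv.app (Ψ'.obj A)) (SR₂.pull (SR₂.base.map (σ.hom.app A)) x)) hR).trans ?_
  refine (congrArg (fun x => SR₂.pull (β₂.inv.app (Ψ'.obj A)) x) (SR₂.pull_comp _ _ _).symm).trans ?_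
  exact (SR₂.pull_comp _ _ _).symm

/-- **(G2), θ-letter, packaged** (the shape consumed by the (G3) closer and the knit): for `A` in `(C₁^pf)^un-tr`
and any `θ : Φ₁^pf(X) → Φ₂^pf(Base (Ψ′A))`, `X = Base A`, satisfying the Div-clause on arrows out of `A`, if every
`m ∈ Φ₁^pf(X)` is such a `Div` (Def. 1.3 (ii)), then `∃ γ : Base(Ψ′A) ≅ ΨBase(X)` (explicitly the composite
`(β₂_{Ψ′A})⁻¹ ≫ Base(σ_A) ≫ η^rlf_{u₁A} ≫ ΨBase(β₁_A)`) with `ι₂(θ m) = γ^*(E^rlf_X(ι₁ m))` for all `m`.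
[cite: MochizukiFrdI2008, Thm. 6.4 (iii) p.114] -/
theorem exists_baseIso_transport_compat_of_divClause (A : U₁)
    (θ : SU₁.Mon (SU₁.base.obj A) → SU₂.Mon (SU₂.base.obj (Ψ'.obj A)))
    (hθ : ∀ ⦃B : U₁⦄ (φ : A ⟶ B), θ (SU₁.div φ) = SU₂.div (Ψ'.map φ))
    (hgen : ∀ m : SU₁.Mon (SU₁.base.obj A), ∃ (B : U₁) (φ : A ⟶ B), SU₁.div φ = m) :
    ∃ γ : SU₂.base.obj (Ψ'.obj A) ≅ ΨB.obj (SU₁.base.obj A),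
      γ.hom = β₂.inv.app (Ψ'.obj A) ≫ SR₂.base.map (σ.hom.app A) ≫ ηr.hom.app (u₁.obj A) ≫ ΨB.map (β₁.hom.app A) ∧
      ∀ m : SU₁.Mon (SU₁.base.obj A), ι₂ _ (θ m) = SR₂.pull γ.hom (Er.iso (SU₁.base.obj A) (ι₁ _ m)) := by
  refine ⟨(β₂.app (Ψ'.obj A)).symm ≪≫ SR₂.base.mapIso (σ.app A) ≪≫ ηr.app (u₁.obj A) ≪≫ ΨB.mapIso (β₁.app A),
    ?_, fun m => ?_⟩
  · simp only [Iso.trans_hom, Iso.symm_hom, Iso.app_hom, Iso.app_inv, Functor.mapIso_hom]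
  · obtain ⟨B, φ, rfl⟩ := hgen m
    refine (transport_square_compat_of_divClause SU₁ SU₂ SR₁ SR₂ ι₁ ι₂ u₁ β₁ hu₁ u₂ β₂ hu₂ Ψ' Ψr ΨB Er ηr hΨr σ
      hsharp φ θ (hθ φ)).trans ?_
    exact congrArg (fun f => SR₂.pull f (Er.iso (SU₁.base.obj A) (ι₁ _ (SU₁.div φ))))
      (by simp only [Iso.trans_hom, Iso.symm_hom, Iso.app_hom, Iso.app_inv, Functor.mapIso_hom])

end Square

end PreFrobenioidData

end Literature.AlgebraicGeometry.Frobenioids
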